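import Summits.Ventures.PercRepro.C025ProfileFourCapEBasics
/-!
# (Cap) OF RULE E — (G1): the number of independent pairs of `M／B` (night-3 g10)
NIGHT3-G10-CAPE-PROOF.md §1 (G1): for a rank-`2` set `B` of a matroid of rank `R`,
`N_B = |G_B| ≥ C(R−2, 2) + (|F_B| − (R−2))·(R−3)`. Proof: a base `I ⊇ I₀` of `M` with `I₀` a basis of `B` gives
`D := I ∖ I₀ ⊆ F_B` with `|D| = R − 2` and every pair of `D` independent in `M／B`; a point `e ∈ F_B ∖ D` has
`ρ(B ∪ {e, d}) = 3` for at most one `d ∈ D` (two such `d, d′` lie in `cl(B ∪ e)`, so `ρ(B ∪ {d, d′}) ≤ 3`).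
Also (G3): `crk M B ≤ |F_B| + ρ(cl B ∖ B)`-type bounds (`crk_le_of_subset_union`).
-/
open scoped Matroid
namespace PercRepro
open Set Finset ThmH
section CapEBasis
variable {α : Type} [DecidableEq α] {M : Matroid α} [M.Finite]

/-- A point of `F_B` raises the rank of `B` (rank `2`) to `3`. -/
theorem eRk_insert_Fs_eq_three {B : Finset α} (hB2 : M.eRk (B : Set α) = 2) {e : α} (he : e ∈ Fs M B) :
    M.eRk ((insert e B : Finset α) : Set α) = 3 := by
  have heE : e ∈ M.E := by rw [← coe_gr]; exact_mod_cast Fs_subset_gr B he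
  have hecl : e ∉ M.closure (B : Set α) := by
    intro h; exact (mem_Fs.1 he).2 (by rw [← Finset.mem_coe, coe_clF]; exact h)
  rw [Finset.coe_insert, Matroid.eRk_insert_eq_add_one ⟨heE, hecl⟩, hB2]; rfl

/-- If `ρ(B ∪ {e, d}) = 3` with `e ∈ F_B`, then `d ∈ cl(B ∪ e)`. -/
theorem mem_closure_insert_of_eRk_pair_eq_three {B : Finset α} (hB2 : M.eRk (B : Set α) = 2)
    {e d : α} (he : e ∈ Fs M B) (hd : d ∈ gr M) (h3 : M.eRk ((B ∪ {e, d} : Finset α) : Set α) = 3) :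
    d ∈ M.closure ((insert e B : Finset α) : Set α) := by
  by_contra hcon
  have hdE : d ∈ M.E := by rw [← coe_gr]; exact_mod_cast hd
  have := Matroid.eRk_insert_eq_add_one (M := M) ⟨hdE, hcon⟩
  rw [← Finset.coe_insert, eRk_insert_Fs_eq_three hB2 he] at this
  have heq : (insert d (insert e B) : Finset α) = B ∪ {e, d} := by
    ext w; simp only [Finset.mem_insert, Finset.mem_union, Finset.mem_singleton]; tauto
  rw [heq, h3] at this
  norm_num at this

/-- A point `e ∈ F_B` is parallel in `M／B` to at most one point of a family `D` of pairwise independent points. -/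
theorem card_filter_not_four_le_one {B D : Finset α} (hBg : B ⊆ gr M) (hB2 : M.eRk (B : Set α) = 2)
    (hD : D ⊆ Fs M B) (hDind : ∀ d ∈ D, ∀ d' ∈ D, d ≠ d' → M.eRk ((B ∪ {d, d'} : Finset α) : Set α) = 4)
    {e : α} (he : e ∈ Fs M B) :
    (D.filter (fun d => M.eRk ((B ∪ {e, d} : Finset α) : Set α) ≠ 4)).card ≤ 1 := by
  rw [Finset.card_le_one]
  intro d hd d' hd'
  rw [Finset.mem_filter] at hd hd'
  by_contra hne
  have h3 := eRk_union_pair_eq_three hB2 he hd.2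
  have h3' := eRk_union_pair_eq_three hB2 he hd'.2
  have hdcl := mem_closure_insert_of_eRk_pair_eq_three hB2 he (Fs_subset_gr B (hD hd.1)) h3
  have hd'cl := mem_closure_insert_of_eRk_pair_eq_three hB2 he (Fs_subset_gr B (hD hd'.1)) h3'
  have h4 := hDind d hd.1 d' hd'.1 hne
  have hsub : ((B ∪ {d, d'} : Finset α) : Set α) ⊆ M.closure ((insert e B : Finset α) : Set α) := by
    intro w hw
    rw [Finset.coe_union, Set.mem_union, Finset.mem_coe, Finset.mem_coe, Finset.mem_insert,
      Finset.mem_singleton] at hw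
    rcases hw with hw | rfl | rfl
    · exact M.subset_closure _ (by rw [← coe_gr]; exact_mod_cast Finset.insert_subset (Fs_subset_gr B he) hBg)
        (by rw [Finset.mem_coe]; exact Finset.mem_insert_of_mem hw)
    · exact hdcl
    · exact hd'cl
  have := M.eRk_mono hsub
  rw [M.eRk_closure_eq, eRk_insert_Fs_eq_three hB2 he, h4] at this
  norm_num at this

/-- **(G1)** `N_B ≥ C(R−2, 2) + (|F_B| − (R−2))·(R−3)` for a rank-`2` set `B` of a matroid of rank `R`. -/
theorem card_Gfam_ge {R : ℕ} (hR : M.eRank = R) {B : Finset α} (hB : B ∈ Profile.Rq M 2) :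
    Nat.choose (R - 2) 2 + ((Fs M B).card - (R - 2)) * (R - 3) ≤ (Gfam M B).card := by
  obtain ⟨hBg, hB2⟩ := Profile.mem_Rq.1 hB
  have hBE : (B : Set α) ⊆ M.E := by rw [← coe_gr]; exact_mod_cast hBg
  obtain ⟨I₀, hI₀⟩ := M.exists_isBasis (B : Set α) hBE
  obtain ⟨I, hI, hI₀I⟩ := hI₀.indep.exists_isBase_superset
  have hIE : I ⊆ M.E := hI.subset_ground
  have hIfin : I.Finite := M.ground_finite.subset hIE
  have hI₀fin : I₀.Finite := hIfin.subset hI₀I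
  have hcoeI : ((hIfin.toFinset : Finset α) : Set α) = I := hIfin.coe_toFinset
  have hcoeI₀ : ((hI₀fin.toFinset : Finset α) : Set α) = I₀ := hI₀fin.coe_toFinset
  have hIcard : hIfin.toFinset.card = R := by
    have := hI.encard_eq_eRank
    rw [hR, ← hcoeI, Set.encard_coe_eq_coe_finsetCard] at this
    exact_mod_cast this
  have hI₀card : hI₀fin.toFinset.card = 2 := by
    have := hI₀.encard_eq_eRk
    rw [hB2, ← hcoeI₀, Set.encard_coe_eq_coe_finsetCard] at this
    exact_mod_cast this
  have hI₀IF : hI₀fin.toFinset ⊆ hIfin.toFinset := by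
    rw [← Finset.coe_subset, hcoeI, hcoeI₀]; exact hI₀I
  set D : Finset α := hIfin.toFinset \ hI₀fin.toFinset with hD
  have hDcard : D.card = R - 2 := by rw [hD, Finset.card_sdiff_of_subset hI₀IF, hIcard, hI₀card]
  have hmemD : ∀ d, d ∈ D ↔ d ∈ I ∧ d ∉ I₀ := by
    intro d
    rw [hD, Finset.mem_sdiff, ← Finset.mem_coe, hcoeI, ← Finset.mem_coe, hcoeI₀]
  -- `D ⊆ F_B`
  have hDF : D ⊆ Fs M B := by
    intro d hd
    rw [hmemD] at hd
    have hdE : d ∈ M.E := hIE hd.1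
    refine mem_Fs.2 ⟨by rw [← Finset.mem_coe, coe_gr]; exact hdE, ?_⟩
    intro hcl
    rw [← Finset.mem_coe, coe_clF, ← hI₀.closure_eq_closure] at hcl
    have hind : M.Indep (insert d I₀) := hI.indep.subset (Set.insert_subset hd.1 hI₀I)
    exact ((hI₀.indep.notMem_closure_iff_of_notMem hd.2 hdE).2 hind) hcl
  -- pairs of `D` are independent in `M／B`
  have hDind : ∀ d ∈ D, ∀ d' ∈ D, d ≠ d' → M.eRk ((B ∪ {d, d'} : Finset α) : Set α) = 4 := by
    intro d hd d' hd' hne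
    have hd1 := (hmemD d).1 hd
    have hd'1 := (hmemD d').1 hd'
    -- lower bound: `I₀ ∪ {d, d′}` is an independent 4-set inside `B ∪ {d, d′}` ∪ … no: inside `I`
    have hX : M.Indep (I₀ ∪ ({d, d'} : Finset α)) := by
      apply hI.indep.subset
      intro w hw
      rcases hw with hw | hw
      · exact hI₀I hw
      · rw [Finset.mem_coe, Finset.mem_insert, Finset.mem_singleton] at hw
        rcases hw with rfl | rfl
        exacts [hd1.1, hd'1.1]
    have hXcard : (I₀ ∪ ({d, d'} : Finset α)).encard = 4 := by
      rw [Set.encard_union_eq, Set.encard_coe_eq_coe_finsetCard, Finset.card_pair hne, hI₀.encard_eq_eRk, hB2]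
      · rfl
      · rw [Set.disjoint_left]
        intro w hw hw'
        rw [Finset.mem_coe, Finset.mem_insert, Finset.mem_singleton] at hw'
        rcases hw' with rfl | rfl
        exacts [hd1.2 hw, hd'1.2 hw]
    have hlow : (4 : ℕ∞) ≤ M.eRk ((B ∪ {d, d'} : Finset α) : Set α) := by
      rw [← hXcard, ← hX.eRk_eq_encard]
      apply M.eRk_mono
      intro w hw
      rw [Finset.coe_union, Set.mem_union, Finset.mem_coe]
      rcases hw with hw | hw
      · exact Or.inl (hI₀.subset hw)
      · exact Or.inr hw
    have hup : M.eRk ((B ∪ {d, d'} : Finset α) : Set α) ≤ 4 := by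
      rw [Finset.coe_union]
      refine (M.eRk_union_le_eRk_add_eRk _ _).trans ?_
      rw [hB2]
      have := eRk_le_card (M := M) ({d, d'} : Finset α)
      rw [Finset.card_pair hne] at this
      calc (2 : ℕ∞) + M.eRk (({d, d'} : Finset α) : Set α) ≤ 2 + 2 := add_le_add_right this 2
        _ = 4 := by norm_num
    exact le_antisymm hup hlow
  -- the two families of pairs
  have hpow : D.powersetCard 2 ⊆ Gfam M B := by
    intro Y hY
    rw [Finset.mem_powersetCard] at hY
    obtain ⟨d, d', hne, rfl⟩ := Finset.card_eq_two.1 hY.2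
    refine mem_Gfam.2 ⟨hY.1.trans hDF, Finset.card_pair hne, ?_⟩
    exact hDind d (hY.1 (Finset.mem_insert_self _ _)) d'
      (hY.1 (Finset.mem_insert_of_mem (Finset.mem_singleton_self _))) hne
  let good : α → Finset α := fun e => D.filter (fun d => M.eRk ((B ∪ {e, d} : Finset α) : Set α) = 4)
  let fam : Finset (Finset α) := (Fs M B \ D).biUnion (fun e => (good e).image (fun d => ({e, d} : Finset α)))
  have hfam : fam ⊆ Gfam M B := by
    intro Y hY
    rw [Finset.mem_biUnion] at hY
    obtain ⟨e, he, hY⟩ := hY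
    rw [Finset.mem_image] at hY
    obtain ⟨d, hd, rfl⟩ := hY
    rw [Finset.mem_filter] at hd
    rw [Finset.mem_sdiff] at he
    have hne : e ≠ d := fun h => he.2 (h ▸ hd.1)
    refine mem_Gfam.2 ⟨?_, Finset.card_pair hne, hd.2⟩
    intro w hw
    rw [Finset.mem_insert, Finset.mem_singleton] at hw
    rcases hw with rfl | rfl
    exacts [he.1, hDF hd.1]
  have hgoodcard : ∀ e ∈ Fs M B \ D, R - 3 ≤ (good e).card := by
    intro e he
    rw [Finset.mem_sdiff] at he
    have h1 := card_filter_not_four_le_one hBg hB2 hDF hDind he.1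
    have h2 := Finset.card_filter_add_card_filter_not (s := D)
      (p := fun d => M.eRk ((B ∪ {e, d} : Finset α) : Set α) = 4)
    simp only [ne_eq] at h1
    simp only [good]
    omega
  have hfamcard : ((Fs M B).card - (R - 2)) * (R - 3) ≤ fam.card := by
    have hdisj : ((Fs M B \ D : Finset α) : Set α).PairwiseDisjoint
        (fun e => (good e).image (fun d => ({e, d} : Finset α))) := by
      intro e he e' he' hne
      rw [Function.onFun, Finset.disjoint_left]
      intro Y hY hY'
      rw [Finset.mem_image] at hY hY'
      obtain ⟨d, hd, rfl⟩ := hY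
      obtain ⟨d', hd', heq⟩ := hY'
      rw [Finset.mem_coe, Finset.mem_sdiff] at he he'
      rw [Finset.mem_filter] at hd hd'
      have : e' ∈ ({e, d} : Finset α) := by rw [← heq]; exact Finset.mem_insert_self _ _
      rw [Finset.mem_insert, Finset.mem_singleton] at this
      rcases this with h | h
      · exact hne h.symm
      · exact he'.2 (h ▸ hd.1)
    simp only [fam]
    rw [Finset.card_biUnion hdisj]
    have hsum : ∑ e ∈ Fs M B \ D, (R - 3) ≤ ∑ e ∈ Fs M B \ D, ((good e).image (fun d => ({e, d} : Finset α))).card := by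
      apply Finset.sum_le_sum
      intro e he
      rw [Finset.card_image_of_injOn]
      · exact hgoodcard e he
      · intro d hd d' hd' heq
        rw [Finset.mem_coe, Finset.mem_filter] at hd hd'
        rw [Finset.mem_sdiff] at he
        have hne : e ≠ d' := fun h => he.2 (h ▸ hd'.1)
        simp only at heq
        have : d ∈ ({e, d'} : Finset α) := by
          rw [← heq]; exact Finset.mem_insert_of_mem (Finset.mem_singleton_self _)
        rw [Finset.mem_insert, Finset.mem_singleton] at this
        rcases this with h | h
        · exact absurd h.symm (fun h' => he.2 (h' ▸ hd.1))
        · exact h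
    rw [Finset.sum_const, smul_eq_mul, Finset.card_sdiff_of_subset hDF, hDcard] at hsum
    exact hsum
  have hdisj2 : Disjoint (D.powersetCard 2) fam := by
    rw [Finset.disjoint_left]
    intro Y hY hY'
    rw [Finset.mem_powersetCard] at hY
    rw [Finset.mem_biUnion] at hY'
    obtain ⟨e, he, hY'⟩ := hY'
    rw [Finset.mem_image] at hY'
    obtain ⟨d, _, rfl⟩ := hY'
    rw [Finset.mem_sdiff] at he
    exact he.2 (hY.1 (Finset.mem_insert_self _ _))
  have hunion : D.powersetCard 2 ∪ fam ⊆ Gfam M B := Finset.union_subset hpow hfam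
  have hcard := Finset.card_le_card hunion
  rw [Finset.card_union_of_disjoint hdisj2, Finset.card_powersetCard, hDcard] at hcard
  omega

/-- `crk M B ≤ ρ(X) + ρ(Y)` whenever `E ∖ B ⊆ X ∪ Y`. -/
theorem crk_le_of_subset_union {B X Y : Finset α} (h : gr M \ B ⊆ X ∪ Y) {a b : ℕ}
    (hX : M.eRk (X : Set α) ≤ a) (hY : M.eRk (Y : Set α) ≤ b) : crk M B ≤ a + b := by
  have h1 : M.eRk ((gr M \ B : Finset α) : Set α) ≤ (a : ℕ∞) + b := by
    refine (M.eRk_mono (Finset.coe_subset.2 h)).trans ?_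
    rw [Finset.coe_union]
    exact (M.eRk_union_le_eRk_add_eRk _ _).trans (add_le_add hX hY)
  rw [eRk_gr_sdiff_eq_crk] at h1
  exact_mod_cast h1

/-- The corank is at most the rank. -/
theorem crk_le_eRank {R : ℕ} (hR : M.eRank = R) (B : Finset α) : crk M B ≤ R := by
  have h : M.eRk ((gr M \ B : Finset α) : Set α) ≤ M.eRank := by
    rw [M.eRank_def, ← coe_gr]; exact M.eRk_mono (Finset.coe_subset.2 Finset.sdiff_subset)
  rw [eRk_gr_sdiff_eq_crk, hR] at h
  exact_mod_cast h

end CapEBasis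
end PercRepro
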